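import Summits.SmoothPoincare4.SmoothPoincare4.Theses.SullivanDual
import Summits.SmoothPoincare4.SmoothPoincare4.Theses.SchoenfliesSplit
import Summits.SmoothPoincare4.SmoothPoincare4.Theorems.SullivanDualTarget
import Summits.SmoothPoincare4.SmoothPoincare4.Theorems.SullivanDualTargetRouteLeaves
import Summits.SmoothPoincare4.SmoothPoincare4.Theorems.SullivanDualTargetOfWeakTame

/-!
# Strategist sketch — crux stmt-SmoothPoincare4-7823 (`SullivanDual.Target`), STRATEGY-CENSUS typed statements

Typed forms of the census entries (Transfer / Strengthen / Decomposition / Negation). Nothing here is a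
registered line; the two `theorem`s are kernel-checked compositions quoted in STRATEGY-CENSUS.md.
-/

open scoped Manifold ContDiff Topology InnerProductSpace
open Set Filter Metric
open Literature.Geometry.Kaehler Literature.Geometry.Symplectic
open Literature.Topology.FourManifolds

namespace Summit.SmoothPoincare4.SmoothPoincare4.Cruxes.Target.Strategist

open Summit.SmoothPoincare4.SmoothPoincare4.Theses.SullivanDual
open Summit.SmoothPoincare4.SmoothPoincare4.Theses.SchoenfliesSplit
open Summit.SmoothPoincare4.SmoothPoincare4.Theorems.SullivanDual

/-- The standard complex structure `i` of `ℂ² = ℝ⁴` (coordinates `(y₀ + i y₁, y₂ + i y₃)`), as the linear map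
`(y₀,y₁,y₂,y₃) ↦ (-y₁, y₀, -y₃, y₂)`. -/
noncomputable def stdJ : EuclideanSpace ℝ (Fin 4) →L[ℝ] EuclideanSpace ℝ (Fin 4) :=
  LinearMap.toContinuousLinearMap
    { toFun := fun y => (WithLp.equiv 2 (Fin 4 → ℝ)).symm ![-(y 1), y 0, -(y 3), y 2]
      map_add' := by
        intro a b; ext i; fin_cases i <;> simp <;> ring
      map_smul' := by
        intro c a; ext i; fin_cases i <;> simp <;> ring }

/-- The common "admissible `J`" clauses of the route: `J² = -1`, smooth in tangent coordinates, STANDARD on the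
punctured `ε'`-chart-ball (verbatim the binders of `HyperbolicEnd` / `target_of_weakTame`). -/
def AdmissibleJ {S : HomotopySphere 4} (p : S.carrier)
    (J : ∀ x : punctured p, TangentSpace (𝓡 4) x →L[ℝ] TangentSpace (𝓡 4) x) (ε' : ℝ) : Prop :=
  0 < ε' ∧ Metric.closedBall (extChartAt (𝓡 4) p p) ε' ⊆ (extChartAt (𝓡 4) p).target ∧
  (∀ (x : punctured p) (v : TangentSpace (𝓡 4) x), J x (J x v) = -v) ∧
  (∀ x₀ : punctured p, ContMDiffAt (𝓡 4)
    𝓘(ℝ, EuclideanSpace ℝ (Fin 4) →L[ℝ] EuclideanSpace ℝ (Fin 4)) ∞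
    (inTangentCoordinates (𝓡 4) (𝓡 4) (id : punctured p → punctured p) id
      (fun x => J x) x₀) x₀) ∧
  (∀ x : punctured p, InPuncturedChartBall p ε' x →
    ∀ (v : TangentSpace (𝓡 4) x) (b : EuclideanSpace ℝ (Fin 4)),
    inner ℝ (fderiv ℝ inversion (extChartAt (𝓡 4) p x.1 - extChartAt (𝓡 4) p p)
      (mfderiv (𝓡 4) 𝓘(ℝ, EuclideanSpace ℝ (Fin 4))
        (fun z : punctured p => extChartAt (𝓡 4) p z.1) x (J x v))) b =
    stdSymplecticForm (fderiv ℝ inversion (extChartAt (𝓡 4) p x.1 - extChartAt (𝓡 4) p p)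
      (mfderiv (𝓡 4) 𝓘(ℝ, EuclideanSpace ℝ (Fin 4))
        (fun z : punctured p => extChartAt (𝓡 4) p z.1) x v)) b)

/-! ## Strengthen (S⁺₁): an INTEGRABLE admissible `J` — rigid, no slack (solution set = one `Diff_c`-orbit). -/

/-- `IntegrableEndAt S p`: some admissible `J` on `Σ ∖ p` is INTEGRABLE — every point has a local chart `φ` into
`ℝ⁴ = ℂ²` intertwining `J` with the constant structure `stdJ` (Newlander–Nirenberg form, no Nijenhuis tensor
needed). Classification of surfaces (a compact complex surface `(Σ∖p) ∪ ℓ_∞ ≃ₕ ℂP²` containing a smooth rational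
curve of self-intersection `+1` is `ℂP²`, the curve a line) gives `Σ ∖ p ≅ ℂ²` biholomorphically, standard near
`p`; conversely `S⁴ ∖ p = ℂ²`. So `(∀ S p, IntegrableEndAt S p) ↔ SPC4` with NO slack. -/
def IntegrableEndAt (S : HomotopySphere 4) (p : S.carrier) : Prop :=
  ∃ (J : ∀ x : punctured p, TangentSpace (𝓡 4) x →L[ℝ] TangentSpace (𝓡 4) x) (ε' : ℝ),
    AdmissibleJ p J ε' ∧
    ∀ x : punctured p, ∃ (U : Set (punctured p)) (φ : punctured p → EuclideanSpace ℝ (Fin 4)),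
      IsOpen U ∧ x ∈ U ∧ ContMDiffOn (𝓡 4) 𝓘(ℝ, EuclideanSpace ℝ (Fin 4)) ∞ φ U ∧ Set.InjOn φ U ∧
      (∀ y ∈ U, Function.Injective (mfderiv (𝓡 4) 𝓘(ℝ, EuclideanSpace ℝ (Fin 4)) φ y)) ∧
      ∀ y ∈ U, ∀ v : TangentSpace (𝓡 4) y,
        mfderiv (𝓡 4) 𝓘(ℝ, EuclideanSpace ℝ (Fin 4)) φ y (J y v) =
          stdJ (mfderiv (𝓡 4) 𝓘(ℝ, EuclideanSpace ℝ (Fin 4)) φ y v)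

/-! ## Strengthen/weaken (door (c), maximal symplectic slack): CORE-ONLY closed taming. -/

/-- `CoreWeakTameAt S p`: some admissible `J` (standard on the punctured `ε'`-ball) is tamed by some smooth
CLOSED 2-form on the CORE only — off a smaller punctured ball `B_r`, `0 < r < ε'` — nothing asked of the form
on `B_r`. Equivalent to SPC4 at `Σ` (weak filling of `(S³, ξ_std)` by the homotopy ball ⇒ strong ⇒ `B⁴`,
Eliashberg 1991 Prop. 3.1 + Gromov–McDuff); the census's "collar upgrade" lemma would feed it into the landed
door (b) `target_of_weakTame`. -/
def CoreWeakTameAt (S : HomotopySphere 4) (p : S.carrier) : Prop :=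
  ∃ (J : ∀ x : punctured p, TangentSpace (𝓡 4) x →L[ℝ] TangentSpace (𝓡 4) x) (ε' r : ℝ),
    AdmissibleJ p J ε' ∧ 0 < r ∧ r < ε' ∧
    ∃ sf : MForm (𝓡 4) (punctured p) ℝ 2, IsSmoothForm sf ∧ IsClosedForm sf ∧
      ∀ (x : punctured p), ¬ InPuncturedChartBall p r x →
        ∀ (v : TangentSpace (𝓡 4) x), v ≠ 0 → 0 < sf x ![v, J x v]

/-- COLLAR UPGRADE (census lemma CU, believed provable over the tree, size L): core-only closed taming of an
admissible `J` upgrades to closed taming EVERYWHERE of the same `J` (make the form `C • (ι ∘ (e − e p))^* ω₀`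
far out by a radial interpolation of primitives inside the flat region, where `J` is the model structure and
round spheres are `J`-convex). With door (b) this is door (c): `(∀ S p, CoreWeakTameAt S p) → Target`. -/
def CollarUpgrade : Prop :=
  ∀ (S : HomotopySphere 4) (p : S.carrier)
    (J : ∀ x : punctured p, TangentSpace (𝓡 4) x →L[ℝ] TangentSpace (𝓡 4) x) (ε' r : ℝ),
    AdmissibleJ p J ε' → 0 < r → r < ε' →
    (∃ sf : MForm (𝓡 4) (punctured p) ℝ 2, IsSmoothForm sf ∧ IsClosedForm sf ∧
      ∀ (x : punctured p), ¬ InPuncturedChartBall p r x →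
        ∀ (v : TangentSpace (𝓡 4) x), v ≠ 0 → 0 < sf x ![v, J x v]) →
    ∃ sf' : MForm (𝓡 4) (punctured p) ℝ 2, IsSmoothForm sf' ∧ IsClosedForm sf' ∧
      ∀ (x : punctured p) (v : TangentSpace (𝓡 4) x), v ≠ 0 → 0 < sf' x ![v, J x v]

/-- Door (c), kernel-checked modulo `CollarUpgrade`: core-only closed taming at every `(Σ, p)` gives `Target`
(through the landed door (b) `target_of_weakTame`). -/
theorem target_of_coreWeakTame (hCU : CollarUpgrade)
    (h : ∀ (S : HomotopySphere 4) (p : S.carrier), CoreWeakTameAt S p) : Target := by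
  refine target_of_weakTame fun S p => ?_
  obtain ⟨J, ε', r, hJ, hr, hrε, sf, hsf, hsfc, htame⟩ := h S p
  obtain ⟨sf', hsf', hsfc', htame'⟩ := hCU S p J ε' r hJ hr hrε ⟨sf, hsf, hsfc, htame⟩
  obtain ⟨hε', hball, hJ2, hJs, hstd⟩ := hJ
  exact ⟨J, ε', hε', hball, hJ2, hJs, hstd, sf', hsf', hsfc', htame'⟩

/-! ## Decomposition D1 (landed, this route's spine) and D2 (another route's cruxes, through the summit). -/

/-- D1 (= `target_of_routeLeaves`, p137558): `Target` from the route's three open leaves. -/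
example : HyperbolicEnd → PencilLocalFamily → LimitOfEmbeddedPlanes → Target :=
  target_of_routeLeaves

/-- D2: `Target` from route SchoenfliesSplit's cruxes (A) punctured embedding, (B♯) shell capping and its
provable-now bridge — the composition passes THROUGH the summit (`∀ Σ, Σ ≅ S⁴`), which is why it is recorded in
the census and not registered as a line of this crux. -/
theorem target_of_schoenfliesSplit (hA : SchsplitPuncturedEmbeds) (hCap : SchsplitShellCap)
    (hBridge : SchsplitCapBridge) : Target :=
  target_of_forall_nonempty_diffeomorph_sphere (hBridge hA hCap)

/-! ## Negation (landed): a counterexample to the crux is an exotic 4-sphere and nothing less. -/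

example (h : ¬ Target) :
    ∃ S : HomotopySphere 4, IsEmpty (S.carrier ≃ₘ⟮𝓡 4, 𝓡 4⟯ Metric.sphere (0 : EuclideanSpace ℝ (Fin 5)) 1) :=
  exists_isEmpty_diffeomorph_sphere_of_not_target h

end Summit.SmoothPoincare4.SmoothPoincare4.Cruxes.Target.Strategist
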